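import Summits.CriticalPhenomena.PercolationContinuityZ3.Theorems.Transplant.SharpnessRayIsoLeftArm
import Summits.CriticalPhenomena.CardyFormulaZ2.Theorems.CardyBoundaryCoulombGasHalfPlaneMarkDensityLawLisoOfGlobal
import HarnessLib

/-!
# Transplant sharpness LVII — Werner's global event forces an open arm AND a closed dual arm at the leftmost
# joined boundary point (deterministic half of the half-plane two-arm LOWER bound, bond `ℤ²`)

builds on p205010 (kernel theorem, internal audit signed; external expert review pending).
Status sentence (coordinator 2026-08-20T04:30Z): "θ(p_c) = 0 on ℤ^d, all d ≥ 2 — kernel-verified (Lean 4/Mathlib,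
standard axioms); internal adversarial audit SIGNED 2026-08-20 04:29Z; external expert review pending."

Lane `prim-bschramm`, seat p5 (sharpness); memo `run/shared/lean/prim/bschramm/P5-SHARPNESS.md` §48 (row 85, kernel
programme "RAY"; plan `run/shared/lean/prim/bschramm/prim-bschramm-p5-g22/RAY-PLAN.md`, LEMMA X).

W. Werner's counting argument (*Lectures on two-dimensional critical percolation*, PCMI 2007, Lecture 2, first exercise
sheet, "Two-arm exponent in the half-plane"), as realised in the tree by the crux line `HalfPlaneMarkDensityLaw/Sketch`
of `CardyFormulaZ2` in PRIMAL form (`TwoArmLower.LisoOfGlobal.exists_liso`: shield + pillar + beam ⇒ a left-isolated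
arm point `u ∈ [0,4q]`), upgraded here to the genuine TWO-ARM form needed by the reinforced-ray programme: under

* (shield) no open left–right crossing of `[0,q] × [0,4q]`,
* (pillar) an open top–bottom crossing of `[2q,4q] × [0,4q]`,
* (beam) an open left–right crossing of `[2q,8q+1] × [0,4q]`,

the least `u ∈ [0,4q]` with `(u,0)` joined inside the strip `ℤ × [0,4q]` to the column `8q+1` carries an OPEN arm from
`(u,0)` inside `siteBox u (2q−1)` AND a CLOSED DUAL arm from the moat face `(u−1,−1)` inside `faceBox (u−1) (2q−1)`, both
to sup-distance `2q − 1` (`exists_openArm_dualArm_of_global`).  The dual arm comes from `Ray.isoLeft_twoArm` (LVI)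
applied to the configuration RESTRICTED TO THE STRIP (so that "joined inside the half-plane" means "joined inside the
strip", where minimality and the shield give the left isolation); its steps cross closed strip edges, hence closed
edges of `ω`.

References: W. Werner (2009), Lecture 2; G. F. Lawler, O. Schramm, W. Werner, EJP 7 (2002), App. A;
G. Grimmett, *Percolation* (1999), §11.2.
-/

noncomputable section

namespace Summit.CriticalPhenomena.PercolationContinuityZ3.Theorems.TransplantSharpness

namespace Ray

open Literature.Probability.Percolation Literature.Probability.LatticeModels
open Literature.Probability.Percolation.Z2HalfPlane (leg adj_leg Far faceBox siteBox)
open MeasureTheory Filter Set SimpleGraph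
open Summit.CriticalPhenomena.CardyFormulaZ2.Theorems.HalfPlaneMarkDensityLaw.Negative
open Summit.CriticalPhenomena.CardyFormulaZ2.Cruxes.HalfPlaneMarkDensityLaw.SketchLine

/-! ### Restricting a configuration to the edges inside a set of sites -/

/-- The edges of `ω` with both endpoints in `T`. [folklore] -/
theorem restrict_subset (ω : BondConfig (Site 2)) (T : Set (Site 2)) :
    ω ∩ {e | ∀ x ∈ e, x ∈ T} ⊆ ω := Set.inter_subset_left

/-- An open connection inside `T` is an open connection of the restricted configuration inside any `S ⊇ T`.
[folklore] -/
theorem openConnIn_restrict_of_openConnIn {ω : BondConfig (Site 2)} (hω : ω ⊆ (zdGraph 2).edgeSet)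
    {T S : Set (Site 2)} (hTS : T ⊆ S) {x y : Site 2} (h : ω ∈ openConnIn T x y) :
    ω ∩ {e | ∀ x ∈ e, x ∈ T} ∈ openConnIn S x y := by
  obtain ⟨p, hpT, hpω⟩ := exists_walk_of_mem_openConnIn hω h
  refine mem_openConnIn_of_walk p (fun z hz => hTS (hpT z hz)) fun e he => ⟨hpω e he, ?_⟩
  intro z hz
  exact hpT z (SelfDual.mem_support_of_mem_of_mem_edges p he hz)

/-- A walk whose edges have all their endpoints in `T`, started in `T`, stays in `T`. [folklore] -/
theorem support_subset_of_edges {T : Set (Site 2)} {x y : Site 2} (p : (zdGraph 2).Walk x y) (hxT : x ∈ T)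
    (hp : ∀ e ∈ p.edges, ∀ z ∈ e, z ∈ T) : ∀ z ∈ p.support, z ∈ T := by
  induction p with
  | nil => intro z hz; simp only [Walk.support_nil, List.mem_singleton] at hz; subst hz; exact hxT
  | @cons a b c hadj q ih =>
    intro z hz
    rw [Walk.support_cons, List.mem_cons] at hz
    rcases hz with rfl | hz
    · exact hxT
    · have hbT : b ∈ T := hp s(a, b) (by simp) b (Sym2.mem_mk_right a b)
      exact ih hbT (fun e he => hp e (by rw [Walk.edges_cons]; exact List.mem_cons_of_mem _ he)) z hz

/-- Conversely, an open connection of the restricted configuration (inside any `S`) is an open connection of `ω`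
inside `T`, provided the starting site lies in `T`. [folklore] -/
theorem openConnIn_of_openConnIn_restrict {ω : BondConfig (Site 2)} (hω : ω ⊆ (zdGraph 2).edgeSet)
    {T S : Set (Site 2)} {x y : Site 2} (hxT : x ∈ T) (h : ω ∩ {e | ∀ x ∈ e, x ∈ T} ∈ openConnIn S x y) :
    ω ∈ openConnIn T x y := by
  obtain ⟨p, -, hpω⟩ := exists_walk_of_mem_openConnIn ((restrict_subset ω T).trans hω) h
  exact mem_openConnIn_of_walk p (support_subset_of_edges p hxT fun e he => (hpω e he).2)
    fun e he => (hpω e he).1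

/-! ### The two arms at the leftmost joined point -/

/-- **Werner's global event ⇒ open arm and closed dual arm** (deterministic, bond `ℤ²`).  For `q ≥ 2` and a lattice
configuration `ω`: no open left–right crossing of `[0,q] × [0,4q]`, an open top–bottom crossing of `[2q,4q] × [0,4q]`
and an open left–right crossing of `[2q,8q+1] × [0,4q]` give some `u ∈ [0,4q]` with an open path from `(u,0)` inside
`siteBox u (2q−1)` to a site `Far (2q−1) u`, and a dual-open (i.e. `ω`-closed) path of `dualConfig ω` from the moat
face `(u−1,−1)` inside `faceBox (u−1) (2q−1)` to a face `Far (2q−1) (u−1)`.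
[cite: WernerPCMI2009, Lecture 2, first exercise sheet] [cite: LawlerSchrammWernerEJP2002, Appendix A] -/
theorem exists_openArm_dualArm_of_global {q : ℕ} (hq : 2 ≤ q) {ω : BondConfig (Site 2)}
    (hω : ω ⊆ (zdGraph 2).edgeSet) (hD : ω ∉ lrCrossing q (4 * q))
    (hV : ω ∈ openCrossing
      ((· + (![2 * (q : ℤ), 0] : Site 2)) '' (↑(rectangle (2 * q) (4 * q)) : Set (Site 2)))
      ((· + (![2 * (q : ℤ), 0] : Site 2)) '' (↑(bottomSide (2 * q) (4 * q)) : Set (Site 2)))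
      ((· + (![2 * (q : ℤ), 0] : Site 2)) '' (↑(topSide (2 * q) (4 * q)) : Set (Site 2))))
    (hH : ω ∈ openCrossing
      ((· + (![2 * (q : ℤ), 0] : Site 2)) '' (↑(rectangle (6 * q + 1) (4 * q)) : Set (Site 2)))
      ((· + (![2 * (q : ℤ), 0] : Site 2)) '' (↑(leftSide (6 * q + 1) (4 * q)) : Set (Site 2)))
      ((· + (![2 * (q : ℤ), 0] : Site 2)) '' (↑(rightSide (6 * q + 1) (4 * q)) : Set (Site 2)))) :
    ∃ u : ℤ, 0 ≤ u ∧ u ≤ 4 * (q : ℤ) ∧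
      (∃ v : Site 2, Far (2 * q - 1) u v ∧ ω ∈ openConnIn ↑(siteBox u (2 * q - 1)) (bpt u) v) ∧
      (∃ g : Site 2, Far (2 * q - 1) (u - 1) g ∧
        dualConfig ω ∈ openConnIn ↑(faceBox (u - 1) (2 * q - 1)) ![u - 1, -1] g) := by
  classical
  set T : Set (Site 2) := {z : Site 2 | 0 ≤ z 1 ∧ z 1 ≤ 4 * (q : ℤ)} with hT
  have hTH : T ⊆ halfPlane := fun _ hz => hz.1
  obtain ⟨b₀, hb₀0, hb₀4, hReach⟩ := TwoArmLower.LisoOfGlobal.exists_reach hω hV hH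
  -- the leftmost point of `[0,4q] × {0}` joined inside `T` to the column `8q+1`
  obtain ⟨u, ⟨hu0, hu4, w, hw0, huw⟩, humin⟩ := Int.exists_least_of_bdd
    (P := fun u : ℤ ↦ 0 ≤ u ∧ u ≤ 4 * (q : ℤ) ∧
      ∃ y : Site 2, y 0 = 8 * (q : ℤ) + 1 ∧ ω ∈ openConnIn T (bpt u) y)
    ⟨0, fun _ hz ↦ hz.1⟩ ⟨b₀, hb₀0, hb₀4, hReach⟩
  refine ⟨u, hu0, hu4, ?_⟩
  -- the strip-restricted configuration
  set ωT : BondConfig (Site 2) := ω ∩ {e | ∀ x ∈ e, x ∈ T} with hωT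
  have hωTω : ωT ⊆ ω := restrict_subset ω T
  have hωT : ωT ⊆ (zdGraph 2).edgeSet := hωTω.trans hω
  -- the scale of the two-arm lemma
  set s : ℕ := 2 * q with hs
  have hs4 : (u : ℤ) - u + 4 ≤ s := by rw [hs]; push_cast; omega
  -- far: the column `8q+1` is at horizontal distance `≥ 4q+1 ≥ 2s` from `u`
  have hfar : ∃ v : Site 2, ((u : ℤ) - u + 2 * s ≤ |v 0 - u| ∨ (u : ℤ) - u + 2 * s ≤ v 1) ∧
      ωT ∈ openConnIn halfPlane (bpt u) v := by
    refine ⟨w, Or.inl ?_, openConnIn_restrict_of_openConnIn hω hTH huw⟩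
    rw [hw0, hs]; push_cast
    rw [abs_of_nonneg (by omega)]; omega
  -- free: no boundary site left of `u` is joined to `u` inside the strip
  have hfree : ∀ v₀ : ℤ, u - s ≤ v₀ → v₀ < u → ωT ∉ openConnIn halfPlane (bpt u) (bpt v₀) := by
    intro v₀ _ hv₀u hconn
    have huT : bpt u ∈ T := by
      show 0 ≤ (bpt u) 1 ∧ (bpt u) 1 ≤ 4 * (q : ℤ)
      simp only [bpt, Matrix.cons_val_one, Matrix.cons_val_fin_one]; omega
    have h1 : ω ∈ openConnIn T (bpt u) (bpt v₀) := openConnIn_of_openConnIn_restrict hω huT hconn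
    have h2 : ω ∈ openConnIn T (bpt v₀) w := by
      rw [openConnIn_comm] at h1
      exact PlanarDuality.openConnIn_trans h1 huw
    rcases le_or_gt 0 v₀ with h0 | h0
    · have hle := humin v₀ ⟨h0, by omega, w, hw0, h2⟩
      omega
    · exact hD (TwoArmLower.LisoOfGlobal.lrCrossing_of_conn hω
        (v := bpt v₀) (by simp only [bpt, Matrix.cons_val_zero]; omega) (by rw [hw0]; omega) h2)
  obtain ⟨⟨z₁, qO, hz₁far, hqObox, hqOω⟩, ⟨g, qd, hgfar, hqdbox, hqdkey⟩⟩ :=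
    isoLeft_twoArm hωT (t := u) (t' := u) (s := s) le_rfl hs4 hfar hfree
  have hs1 : s - 1 = 2 * q - 1 := by rw [hs]
  refine ⟨⟨z₁, by rw [← hs1]; exact hz₁far, ?_⟩, ⟨g, by rw [← hs1]; exact hgfar, ?_⟩⟩
  · rw [← hs1]
    exact mem_openConnIn_of_walk qO (fun z hz => Finset.mem_coe.2 (hqObox z hz))
      fun e he => hωTω (hqOω e he)
  · rw [← hs1]
    refine Z2HalfPlane.dualConfig_mem_openConnIn_of_walk qd (fun z hz => Finset.mem_coe.2 (hqdbox z hz))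
      fun d hd => ?_
    -- the crossed edge lies inside the strip, so "closed in `ωT`" means "closed in `ω`"
    obtain ⟨hclosed, hin⟩ := hqdkey d hd
    intro hmem
    refine hclosed ⟨hmem, fun x hx => ?_⟩
    obtain ⟨-, -, hx0, hx1⟩ := hin x hx
    exact ⟨hx0, by rw [hs] at hx1; push_cast at hx1; omega⟩

end Ray

end Summit.CriticalPhenomena.PercolationContinuityZ3.Theorems.TransplantSharpness
-- build-touch 2026-08-25T06:46Z T1-7 (lead g18): re-land of p391739, declarations byte-identical
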